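import Literature.NumberTheory.Rogawski1990.LocalEndoscopicScalarBlockPartnerCM       -- ★ p06: `conj_mul_self_eq_one_of_local_one`, `conj_det_mul_det_eq_one_of_local_two`, `smul_one_mem_unitaryGroupOfForm`
import Literature.NumberTheory.Automorphic.RankTwoEigenframeOfSplitCharpoly          -- ★ (E1) `exists_eigenframe_of_isRoot_map_of_separable`
import Literature.NumberTheory.Automorphic.QuadraticLocalBaseChange                  -- ★ `continuous_conjLocal`
import Literature.NumberTheory.Rogawski1990.UnitaryRankTwoFrameAlgebra                 -- ★ generic 2×2 frame algebra (sibling, same pen)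
import HarnessLib

/-!
# The torus transport `τ : Z_H(ε_H) → H_v` at an `H`-regular, `G`-singular point (Rogawski 1990 §8.2 Prop. 8.2.1 (c); §4.3 p. 42)

Topic `NumberTheory/Rogawski1990`; namespace `Literature.NumberTheory.Rogawski1990`.  THEOREMS ONLY (no definition, no instance, no notation, no named fact, no `sorry`).
Cell `pub/hodgecm-mathlib`, crux H413 = `stmt-HodgeConjecture-24833`; pay-down line «N6nsGerm» (`Cruxes/H413/Lines/F0_P3a_N6nsGerm.lean` ED. 1.3), stub `stub_N6nsS2`;
LEAD F0P3a-plan (g9) WORD T8-102 (i) «S2 torus-transport `τ`-rider» (pen A-p19 (g21); register `F0/P2/p02/g8/REGISTER-N6nsGerm-binders` de2b9d0b16dd7267, row «dock + torus transport»).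

THE OBJECT.  `H_v = U(Φ₂)(L⁺_v) × U(Φ₁)(L⁺_v)` at a NON-SPLIT place, `ε_H = (A, u) ∈ H_v` with `A` regular semisimple (★ `IsRegularElt`) and `ι(ε_H)` NOT regular: then
`χ_A = (X − u)(X − b)`, `u ≠ b`, both in `L_w¹` (★ p06 `exists_scalarBlockPartner`), and the torus `Z_H(ε_H) ∋ t = (P·diag(α_t, β_t)·P⁻¹, γ_t)` in an eigenframe `P` of `A`
(★ `exists_eigenframe_of_isRoot_map_of_separable`).  THE TRANSPORT swaps the rôles of `β` and `γ`: **`τ t := (P·diag(α_t, γ_t)·P⁻¹, β_t)`** — continuous, `τ ε_H = ε♭ := (u·1₂, b)`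
(the scalar-block partner, where ★ `exists_centralDock_of_fst_eq_smul_one` docks `H_v ≃ₜ* Z_{G′_v}(ε)`), and `χ_{ι(τ t)} = χ_{ι(t)}` (same eigenvalue multiset), so `τ` preserves
`G`-regularity — the binders `(εf) (τ) (hτc) (hτ₀) (hτreg)` of ★ `exists_nhds_stableOrbitalIntegralRel_eq_of_torus_singular_inv` (tree :205–:214).

* The generic `2 × 2` frame algebra (commuting ⇒ diagonal, Gram `J`-orthogonality, unitarity of `P·diag(e)·P⁻¹`, charpolys, `GL`-continuity) is the sibling module
  ★ `UnitaryRankTwoFrameAlgebra`; here only the CM theorem **`exists_torusTransport`**.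
HONEST SCOPE.  Algebra and continuity; HC_CM is proved only modulo the printed citations until rung 0 closes; this file proves no printed statement.

## References
* J. D. Rogawski, *Automorphic Representations of Unitary Groups in Three Variables*, Ann. of Math. Stud. 123 (1990), §8.2 Prop. 8.2.1 (c) pp. 113–115; §4.3 p. 42; §3.6 p. 31. [Rogawski1990]
* R. P. Langlands, D. Shelstad, *Descent for transfer factors* (1990), §2.4. [LanglandsShelstad1990Descent]
-/

set_option autoImplicit false

noncomputable section

open NumberField IsDedekindDomain Matrix Polynomial Topology Filter
open scoped MatrixGroups

namespace Literature.NumberTheory.Rogawski1990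

open Literature.NumberTheory.Automorphic Literature.NumberTheory.Automorphic.UnitaryGroup

/-! ## §2 The torus transport at an `H`-regular, `G`-singular point -/

section CM

variable (L : Type) [Field L] [NumberField L] [IsCMField L] (v : HeightOneSpectrum (𝓞 ↥(maximalRealSubfield L)))

set_option maxHeartbeats 800000 in
-- ONE assembly theorem: the `let τ` with dependent membership proofs is zeta-expanded at every use (LEAD rule: scoped `maxHeartbeats` on one assembly theorem)
/-- **THE TORUS TRANSPORT `τ`** (the binders `(εf) (τ) (hτc) (hτ₀) (hτreg)` of ★ `exists_nhds_stableOrbitalIntegralRel_eq_of_torus_singular_inv`).  At a non-split place, for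
`ε_H = (A, u) ∈ H_v` with `A` regular semisimple and `ι(ε_H)` singular: there are `ε♭ ∈ H_v` and a CONTINUOUS `τ : Z_H(ε_H) → H_v` with `τ ε_H = ε♭`, `ε♭ = (u·1₂, b)` with `b ≠ u`
(so ★ `exists_centralDock_of_fst_eq_smul_one` docks at `ε♭`), `χ_{ι(τ t)} = χ_{ι(t)}` for all `t`, whence `τ` preserves `G`-regularity.  Construction: in an eigenframe `P` of `A`
(`A P = P diag(u, b)`), `t = (P diag(α_t, β_t) P⁻¹, γ_t) ↦ (P diag(α_t, γ_t) P⁻¹, β_t)`; unitarity of the image by the `J`-orthogonality of the frame (§1).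
[cite: Rogawski1990, §8.2 Prop. 8.2.1 (c) pp. 113–115; §4.3 p. 42; §3.6 p. 31] [cite: LanglandsShelstad1990Descent, §2.4] -/
theorem exists_torusTransport (w : PlacesOver L v) (hw : IsCMField.complexConj L • w.1 = w.1)
    (εH : (cmDatum L 2 (Matrix.of fun i j : Fin 2 => if i.val + j.val + 1 = 2 then (1 : L) else 0)).Local v ×
      (cmDatum L 1 (Matrix.of fun i j : Fin 1 => if i.val + j.val + 1 = 1 then (1 : L) else 0)).Local v)
    (hregA : IsRegularElt (εH.1.val : GL (Fin 2) (LocalRing L v))) (hsing : ¬ IsLocalGRegular L v εH) :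
    ∃ (εf : (cmDatum L 2 (Matrix.of fun i j : Fin 2 => if i.val + j.val + 1 = 2 then (1 : L) else 0)).Local v ×
        (cmDatum L 1 (Matrix.of fun i j : Fin 1 => if i.val + j.val + 1 = 1 then (1 : L) else 0)).Local v)
      (τ : ↥(Subgroup.centralizer ({εH} : Set ((cmDatum L 2 (Matrix.of fun i j : Fin 2 => if i.val + j.val + 1 = 2 then (1 : L) else 0)).Local v ×
        (cmDatum L 1 (Matrix.of fun i j : Fin 1 => if i.val + j.val + 1 = 1 then (1 : L) else 0)).Local v))) →
        (cmDatum L 2 (Matrix.of fun i j : Fin 2 => if i.val + j.val + 1 = 2 then (1 : L) else 0)).Local v ×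
          (cmDatum L 1 (Matrix.of fun i j : Fin 1 => if i.val + j.val + 1 = 1 then (1 : L) else 0)).Local v),
      Continuous τ ∧ τ ⟨εH, Subgroup.mem_centralizer_singleton_iff.2 rfl⟩ = εf ∧
        (εf.1.val.val : Matrix (Fin 2) (Fin 2) (LocalRing L v)) = finGammaTwo L v εH • (1 : Matrix (Fin 2) (Fin 2) (LocalRing L v)) ∧
        finGammaTwo L v εf ≠ finGammaTwo L v εH ∧
        (∀ t, ((endoEmbLocal L v (τ t)).val.val : Matrix (Fin 3) (Fin 3) (LocalRing L v)).charpoly =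
          ((endoEmbLocal L v (t : (cmDatum L 2 (Matrix.of fun i j : Fin 2 => if i.val + j.val + 1 = 2 then (1 : L) else 0)).Local v ×
            (cmDatum L 1 (Matrix.of fun i j : Fin 1 => if i.val + j.val + 1 = 1 then (1 : L) else 0)).Local v)).val.val : Matrix (Fin 3) (Fin 3) (LocalRing L v)).charpoly) ∧
        ∀ t : ↥(Subgroup.centralizer ({εH} : Set ((cmDatum L 2 (Matrix.of fun i j : Fin 2 => if i.val + j.val + 1 = 2 then (1 : L) else 0)).Local v ×
            (cmDatum L 1 (Matrix.of fun i j : Fin 1 => if i.val + j.val + 1 = 1 then (1 : L) else 0)).Local v))),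
          IsLocalGRegular L v (t : (cmDatum L 2 (Matrix.of fun i j : Fin 2 => if i.val + j.val + 1 = 2 then (1 : L) else 0)).Local v ×
            (cmDatum L 1 (Matrix.of fun i j : Fin 1 => if i.val + j.val + 1 = 1 then (1 : L) else 0)).Local v) → IsLocalGRegular L v (τ t) := by
  classical
  have hc1 : IsCMField.complexConj L ≠ 1 := IsCMField.complexConj_ne_one L
  haveI : Subsingleton (PlacesOver L v) := PlacesOver.subsingleton_of_smul_eq (IsCMField.complexConj L) hc1 w hw
  letI : Field (LocalRing L v) := (LocalRing.isField_of_smul_eq (IsCMField.complexConj L) hc1 w hw).toField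
  -- the matrix `A = εH.1`, its eigenvalue `u` (the `U(Φ₁)`-entry) and its unitarity
  obtain ⟨A, hAdef⟩ : ∃ A : Matrix (Fin 2) (Fin 2) (LocalRing L v), A = εH.1.val.val := ⟨_, rfl⟩
  have hAU : (A.map (conjLocal L (IsCMField.complexConj L) v))ᵀ *
      ((adelicForm L 2 (Matrix.of fun i j : Fin 2 => if i.val + j.val + 1 = 2 then (1 : L) else 0)).map (adeleToLocal L v)) * A =
      (adelicForm L 2 (Matrix.of fun i j : Fin 2 => if i.val + j.val + 1 = 2 then (1 : L) else 0)).map (adeleToLocal L v) := by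
    rw [hAdef]; exact mem_unitaryGroupOfForm_iff.1 εH.1.2
  have hsep : A.charpoly.Separable := by rw [hAdef]; exact hregA
  have hns : ¬ (finCharpolyTwo L v εH * (X - C (finGammaTwo L v εH))).Separable := by
    rw [← charpoly_endoEmbLocal]; exact hsing
  have hroot : A.charpoly.eval (finGammaTwo L v εH) = 0 := by
    rw [hAdef]; exact eval_eq_zero_of_separable_of_not_separable_mul_X_sub_C (hAdef ▸ hsep) _ hns
  have hu1 : conjLocal L (IsCMField.complexConj L) v (finGammaTwo L v εH) * finGammaTwo L v εH = 1 :=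
    conj_mul_self_eq_one_of_local_one L v εH.2
  -- the eigenframe
  have hα : ((A.charpoly).map (Pi.evalRingHom (fun w' : PlacesOver L v => w'.1.adicCompletion L) w)).IsRoot (finGammaTwo L v εH w) :=
    (Polynomial.IsRoot.def.2 hroot).map
  obtain ⟨P, d, hP, hdinj, hd0w⟩ := exists_eigenframe_of_isRoot_map_of_separable L v w hw (εH.1.val) (α := finGammaTwo L v εH w)
    (by rw [← hAdef]; exact hα) (by rw [← hAdef]; exact hsep)
  rw [← hAdef] at hP
  have hd0 : d 0 = finGammaTwo L v εH := funext fun w' => by rw [Subsingleton.elim w' w]; exact hd0w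
  have hd01 : d 0 ≠ d 1 := fun h => absurd (hdinj h) (by decide)
  have hPP : P⁻¹.val * P.val = 1 := by rw [← Units.val_mul, inv_mul_cancel, Units.val_one]
  have hPP' : P.val * P⁻¹.val = 1 := by rw [← Units.val_mul, mul_inv_cancel, Units.val_one]
  have hAconj : A = P.val * diagonal d * P⁻¹.val := by
    calc A = A * (P.val * P⁻¹.val) := by rw [hPP', Matrix.mul_one]
      _ = P.val * diagonal d * P⁻¹.val := by rw [← Matrix.mul_assoc, hP]
  -- `d 1` is norm one: `σ(det A)·det A = 1`, `det A = d 0 · d 1`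
  have hdetA : A.det = d 0 * d 1 := by
    rw [hAconj, Matrix.det_units_conj, det_diagonal, Fin.prod_univ_two]
  have hd11 : conjLocal L (IsCMField.complexConj L) v (d 1) * d 1 = 1 := by
    have h := conj_det_mul_det_eq_one_of_local_two L v εH.1
    rw [← hAdef, hdetA, map_mul, hd0] at h
    calc conjLocal L (IsCMField.complexConj L) v (d 1) * d 1
        = (conjLocal L (IsCMField.complexConj L) v (d 1) * d 1) * (conjLocal L (IsCMField.complexConj L) v (finGammaTwo L v εH) * finGammaTwo L v εH) := by
          rw [hu1, mul_one]
      _ = conjLocal L (IsCMField.complexConj L) v (finGammaTwo L v εH) * conjLocal L (IsCMField.complexConj L) v (d 1) * (finGammaTwo L v εH * d 1) := by ring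
      _ = 1 := h
  have hd00 : conjLocal L (IsCMField.complexConj L) v (d 0) * d 0 = 1 := by rw [hd0]; exact hu1
  have hnorm : ∀ i, conjLocal L (IsCMField.complexConj L) v (d i) * d i = 1 := fun i => by fin_cases i <;> assumption
  -- `σ(dᵢ)·dⱼ ≠ 1` for `i ≠ j`
  have hcross : ∀ i j, i ≠ j → conjLocal L (IsCMField.complexConj L) v (d i) * d j ≠ 1 := by
    intro i j hij h
    apply hij
    apply hdinj
    calc d i = d i * (conjLocal L (IsCMField.complexConj L) v (d i) * d j) := by rw [h, mul_one]
      _ = (conjLocal L (IsCMField.complexConj L) v (d i) * d i) * d j := by ring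
      _ = d j := by rw [hnorm i, one_mul]
  -- the Gram matrix of the frame is diagonal with non-zero diagonal
  obtain ⟨hG01, hG10⟩ := gram_offDiag_eq_zero (conjLocal L (IsCMField.complexConj L) v) _ hAU hP (hcross 0 1 (by decide)) (hcross 1 0 (by decide))
  have hGdet : ((P.val.map (conjLocal L (IsCMField.complexConj L) v))ᵀ *
      ((adelicForm L 2 (Matrix.of fun i j : Fin 2 => if i.val + j.val + 1 = 2 then (1 : L) else 0)).map (adeleToLocal L v)) * P.val).det ≠ 0 := by
    rw [det_mul, det_mul, det_transpose, ← RingHom.mapMatrix_apply, ← RingHom.map_det]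
    refine mul_ne_zero (mul_ne_zero ?_ (isUnit_det_adelicForm_antidiagTwo_local L v).ne_zero) ?_
    · exact (_root_.map_ne_zero _).2 (Matrix.isUnits_det_units P).ne_zero
    · exact (Matrix.isUnits_det_units P).ne_zero
  have hGii : ∀ i : Fin 2, ((P.val.map (conjLocal L (IsCMField.complexConj L) v))ᵀ *
      ((adelicForm L 2 (Matrix.of fun i j : Fin 2 => if i.val + j.val + 1 = 2 then (1 : L) else 0)).map (adeleToLocal L v)) * P.val) i i ≠ 0 := by
    rw [det_fin_two, hG01, hG10, mul_zero, sub_zero] at hGdet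
    intro i; fin_cases i
    · exact left_ne_zero_of_mul hGdet
    · exact right_ne_zero_of_mul hGdet
  -- notation-free abbreviations: `J₂`, `σ`
  obtain ⟨J₂, hJ₂⟩ : ∃ J₂ : Matrix (Fin 2) (Fin 2) (LocalRing L v),
      J₂ = (adelicForm L 2 (Matrix.of fun i j : Fin 2 => if i.val + j.val + 1 = 2 then (1 : L) else 0)).map (adeleToLocal L v) := ⟨_, rfl⟩
  rw [← hJ₂] at hAU hG01 hG10 hGii
  -- every `t ∈ Z_H(εH)`: `t.1` is `P diag(α_t, β_t) P⁻¹` with `α_t, β_t` norm one; `γ_t` (the `U(Φ₁)`-entry) is norm one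
  have hcomm : ∀ t : ↥(Subgroup.centralizer ({εH} : Set ((cmDatum L 2 (Matrix.of fun i j : Fin 2 => if i.val + j.val + 1 = 2 then (1 : L) else 0)).Local v ×
      (cmDatum L 1 (Matrix.of fun i j : Fin 1 => if i.val + j.val + 1 = 1 then (1 : L) else 0)).Local v))),
      (t.1.1.val.val : Matrix (Fin 2) (Fin 2) (LocalRing L v)) * A = A * t.1.1.val.val := by
    intro t
    have ht := (Subgroup.mem_centralizer_singleton_iff.1 t.2)
    -- `ht : t * εH = εH * t`; first components, as matrices
    have h1 := congrArg (fun z : (cmDatum L 2 (Matrix.of fun i j : Fin 2 => if i.val + j.val + 1 = 2 then (1 : L) else 0)).Local v ×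
      (cmDatum L 1 (Matrix.of fun i j : Fin 1 => if i.val + j.val + 1 = 1 then (1 : L) else 0)).Local v => (z.1.val.val : Matrix (Fin 2) (Fin 2) (LocalRing L v))) ht
    rw [hAdef]; exact h1
  have hframe : ∀ t : ↥(Subgroup.centralizer ({εH} : Set ((cmDatum L 2 (Matrix.of fun i j : Fin 2 => if i.val + j.val + 1 = 2 then (1 : L) else 0)).Local v ×
      (cmDatum L 1 (Matrix.of fun i j : Fin 1 => if i.val + j.val + 1 = 1 then (1 : L) else 0)).Local v))),
      (t.1.1.val.val : Matrix (Fin 2) (Fin 2) (LocalRing L v)) * P.val =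
        P.val * diagonal ![(P⁻¹.val * t.1.1.val.val * P.val) 0 0, (P⁻¹.val * t.1.1.val.val * P.val) 1 1] :=
    fun t => mul_frame_eq_frame_mul_diagonal_of_commute P hP hd01 (hcomm t)
  have hmemU : ∀ t : ↥(Subgroup.centralizer ({εH} : Set ((cmDatum L 2 (Matrix.of fun i j : Fin 2 => if i.val + j.val + 1 = 2 then (1 : L) else 0)).Local v ×
      (cmDatum L 1 (Matrix.of fun i j : Fin 1 => if i.val + j.val + 1 = 1 then (1 : L) else 0)).Local v))),
      ((t.1.1.val.val : Matrix (Fin 2) (Fin 2) (LocalRing L v)).map (conjLocal L (IsCMField.complexConj L) v))ᵀ * J₂ * t.1.1.val.val = J₂ :=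
    fun t => by rw [hJ₂]; exact mem_unitaryGroupOfForm_iff.1 t.1.1.2
  have hα1 : ∀ t : ↥(Subgroup.centralizer ({εH} : Set ((cmDatum L 2 (Matrix.of fun i j : Fin 2 => if i.val + j.val + 1 = 2 then (1 : L) else 0)).Local v ×
      (cmDatum L 1 (Matrix.of fun i j : Fin 1 => if i.val + j.val + 1 = 1 then (1 : L) else 0)).Local v))),
      conjLocal L (IsCMField.complexConj L) v ((P⁻¹.val * t.1.1.val.val * P.val) 0 0) * (P⁻¹.val * t.1.1.val.val * P.val) 0 0 = 1 :=
    fun t => norm_diag_eq_one_of_gram (conjLocal L (IsCMField.complexConj L) v) J₂ (hmemU t) (hframe t) 0 (hGii 0)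
  have hβ1 : ∀ t : ↥(Subgroup.centralizer ({εH} : Set ((cmDatum L 2 (Matrix.of fun i j : Fin 2 => if i.val + j.val + 1 = 2 then (1 : L) else 0)).Local v ×
      (cmDatum L 1 (Matrix.of fun i j : Fin 1 => if i.val + j.val + 1 = 1 then (1 : L) else 0)).Local v))),
      conjLocal L (IsCMField.complexConj L) v ((P⁻¹.val * t.1.1.val.val * P.val) 1 1) * (P⁻¹.val * t.1.1.val.val * P.val) 1 1 = 1 :=
    fun t => norm_diag_eq_one_of_gram (conjLocal L (IsCMField.complexConj L) v) J₂ (hmemU t) (hframe t) 1 (hGii 1)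
  have hγ1 : ∀ t : ↥(Subgroup.centralizer ({εH} : Set ((cmDatum L 2 (Matrix.of fun i j : Fin 2 => if i.val + j.val + 1 = 2 then (1 : L) else 0)).Local v ×
      (cmDatum L 1 (Matrix.of fun i j : Fin 1 => if i.val + j.val + 1 = 1 then (1 : L) else 0)).Local v))),
      conjLocal L (IsCMField.complexConj L) v (finGammaTwo L v t.1) * finGammaTwo L v t.1 = 1 :=
    fun t => conj_mul_self_eq_one_of_local_one L v t.1.2
  -- the swapped diagonal `diag(α_t, γ_t)` and its determinant
  have hdetU : ∀ t : ↥(Subgroup.centralizer ({εH} : Set ((cmDatum L 2 (Matrix.of fun i j : Fin 2 => if i.val + j.val + 1 = 2 then (1 : L) else 0)).Local v ×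
      (cmDatum L 1 (Matrix.of fun i j : Fin 1 => if i.val + j.val + 1 = 1 then (1 : L) else 0)).Local v))),
      IsUnit (diagonal ![(P⁻¹.val * t.1.1.val.val * P.val) 0 0, finGammaTwo L v t.1]).det := by
    intro t
    rw [det_diagonal, Fin.prod_univ_two]
    exact (isUnit_iff_exists_inv'.mpr ⟨_, hα1 t⟩).mul (isUnit_iff_exists_inv'.mpr ⟨_, hγ1 t⟩)
  have hnormswap : ∀ t : ↥(Subgroup.centralizer ({εH} : Set ((cmDatum L 2 (Matrix.of fun i j : Fin 2 => if i.val + j.val + 1 = 2 then (1 : L) else 0)).Local v ×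
      (cmDatum L 1 (Matrix.of fun i j : Fin 1 => if i.val + j.val + 1 = 1 then (1 : L) else 0)).Local v))),
      ∀ i, conjLocal L (IsCMField.complexConj L) v (![(P⁻¹.val * t.1.1.val.val * P.val) 0 0, finGammaTwo L v t.1] i) *
        ![(P⁻¹.val * t.1.1.val.val * P.val) 0 0, finGammaTwo L v t.1] i = 1 := by
    intro t i; fin_cases i
    · exact hα1 t
    · exact hγ1 t
  have hβU : ∀ t : ↥(Subgroup.centralizer ({εH} : Set ((cmDatum L 2 (Matrix.of fun i j : Fin 2 => if i.val + j.val + 1 = 2 then (1 : L) else 0)).Local v ×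
      (cmDatum L 1 (Matrix.of fun i j : Fin 1 => if i.val + j.val + 1 = 1 then (1 : L) else 0)).Local v))),
      IsUnit (((P⁻¹.val * t.1.1.val.val * P.val) 1 1) • (1 : Matrix (Fin 1) (Fin 1) (LocalRing L v))).det :=
    fun t => isUnit_det_smul_one (isUnit_iff_exists_inv'.mpr ⟨_, hβ1 t⟩)
  -- THE MAP
  let τ : ↥(Subgroup.centralizer ({εH} : Set ((cmDatum L 2 (Matrix.of fun i j : Fin 2 => if i.val + j.val + 1 = 2 then (1 : L) else 0)).Local v ×
      (cmDatum L 1 (Matrix.of fun i j : Fin 1 => if i.val + j.val + 1 = 1 then (1 : L) else 0)).Local v))) →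
      (cmDatum L 2 (Matrix.of fun i j : Fin 2 => if i.val + j.val + 1 = 2 then (1 : L) else 0)).Local v ×
        (cmDatum L 1 (Matrix.of fun i j : Fin 1 => if i.val + j.val + 1 = 1 then (1 : L) else 0)).Local v := fun t =>
    (⟨P * Matrix.GeneralLinearGroup.mk'' _ (hdetU t) * P⁻¹,
        by rw [hJ₂] at hG01 hG10; exact conj_diagonal_mem_unitaryGroupOfForm_of_gram (conjLocal L (IsCMField.complexConj L) v) _ P hG01 hG10 _ (hnormswap t) (hdetU t)⟩,
      ⟨Matrix.GeneralLinearGroup.mk'' _ (hβU t), smul_one_mem_unitaryGroupOfForm _ _ (hβ1 t) (hβU t)⟩)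
  -- continuity of the coordinates
  have hBc : Continuous fun t : ↥(Subgroup.centralizer ({εH} : Set ((cmDatum L 2 (Matrix.of fun i j : Fin 2 => if i.val + j.val + 1 = 2 then (1 : L) else 0)).Local v ×
      (cmDatum L 1 (Matrix.of fun i j : Fin 1 => if i.val + j.val + 1 = 1 then (1 : L) else 0)).Local v))) => (t.1.1.val.val : Matrix (Fin 2) (Fin 2) (LocalRing L v)) :=
    Units.continuous_val.comp (continuous_subtype_val.comp (continuous_fst.comp continuous_subtype_val))
  have hCc : Continuous fun t : ↥(Subgroup.centralizer ({εH} : Set ((cmDatum L 2 (Matrix.of fun i j : Fin 2 => if i.val + j.val + 1 = 2 then (1 : L) else 0)).Local v ×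
      (cmDatum L 1 (Matrix.of fun i j : Fin 1 => if i.val + j.val + 1 = 1 then (1 : L) else 0)).Local v))) => (t.1.2.val.val : Matrix (Fin 1) (Fin 1) (LocalRing L v)) :=
    Units.continuous_val.comp (continuous_subtype_val.comp (continuous_snd.comp continuous_subtype_val))
  have hDc : Continuous fun t : ↥(Subgroup.centralizer ({εH} : Set ((cmDatum L 2 (Matrix.of fun i j : Fin 2 => if i.val + j.val + 1 = 2 then (1 : L) else 0)).Local v ×
      (cmDatum L 1 (Matrix.of fun i j : Fin 1 => if i.val + j.val + 1 = 1 then (1 : L) else 0)).Local v))) => P⁻¹.val * t.1.1.val.val * P.val :=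
    (continuous_const.matrix_mul hBc).matrix_mul continuous_const
  have hαc : Continuous fun t : ↥(Subgroup.centralizer ({εH} : Set ((cmDatum L 2 (Matrix.of fun i j : Fin 2 => if i.val + j.val + 1 = 2 then (1 : L) else 0)).Local v ×
      (cmDatum L 1 (Matrix.of fun i j : Fin 1 => if i.val + j.val + 1 = 1 then (1 : L) else 0)).Local v))) => (P⁻¹.val * t.1.1.val.val * P.val) 0 0 :=
    hDc.matrix_elem 0 0
  have hβc : Continuous fun t : ↥(Subgroup.centralizer ({εH} : Set ((cmDatum L 2 (Matrix.of fun i j : Fin 2 => if i.val + j.val + 1 = 2 then (1 : L) else 0)).Local v ×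
      (cmDatum L 1 (Matrix.of fun i j : Fin 1 => if i.val + j.val + 1 = 1 then (1 : L) else 0)).Local v))) => (P⁻¹.val * t.1.1.val.val * P.val) 1 1 :=
    hDc.matrix_elem 1 1
  have hγc : Continuous fun t : ↥(Subgroup.centralizer ({εH} : Set ((cmDatum L 2 (Matrix.of fun i j : Fin 2 => if i.val + j.val + 1 = 2 then (1 : L) else 0)).Local v ×
      (cmDatum L 1 (Matrix.of fun i j : Fin 1 => if i.val + j.val + 1 = 1 then (1 : L) else 0)).Local v))) => finGammaTwo L v t.1 :=
    hCc.matrix_elem 0 0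
  have hσc : Continuous (conjLocal L (IsCMField.complexConj L) v) := continuous_conjLocal L (IsCMField.complexConj L) v
  have hτc : Continuous τ := by
    refine Continuous.prodMk (Continuous.subtype_mk ?_ _) (Continuous.subtype_mk ?_ _)
    · exact (continuous_const.mul (continuous_mk''_diagonal_two hαc hγc (hσc.comp hαc) (hσc.comp hγc)
        (fun t => by rw [mul_comm]; exact hα1 t) (fun t => by rw [mul_comm]; exact hγ1 t) hdetU)).mul continuous_const
    · exact continuous_mk''_smul_one hβc (hσc.comp hβc) (fun t => by rw [mul_comm]; exact hβ1 t) hβU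
  -- the frame diagonalises `A` itself: `P⁻¹ A P = diag d`
  have hPAP : P⁻¹.val * A * P.val = diagonal d := by
    rw [Matrix.mul_assoc, hP, ← Matrix.mul_assoc, hPP, Matrix.one_mul]
  -- characteristic polynomials along `τ`
  have hchar : ∀ t : ↥(Subgroup.centralizer ({εH} : Set ((cmDatum L 2 (Matrix.of fun i j : Fin 2 => if i.val + j.val + 1 = 2 then (1 : L) else 0)).Local v ×
      (cmDatum L 1 (Matrix.of fun i j : Fin 1 => if i.val + j.val + 1 = 1 then (1 : L) else 0)).Local v))),
      ((endoEmbLocal L v (τ t)).val.val : Matrix (Fin 3) (Fin 3) (LocalRing L v)).charpoly =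
        ((endoEmbLocal L v (t : (cmDatum L 2 (Matrix.of fun i j : Fin 2 => if i.val + j.val + 1 = 2 then (1 : L) else 0)).Local v ×
          (cmDatum L 1 (Matrix.of fun i j : Fin 1 => if i.val + j.val + 1 = 1 then (1 : L) else 0)).Local v)).val.val : Matrix (Fin 3) (Fin 3) (LocalRing L v)).charpoly := by
    intro t
    rw [charpoly_endoEmbLocal, charpoly_endoEmbLocal]
    -- the `U(Φ₂)`-parts
    have h1 : finCharpolyTwo L v (τ t) = (X - C ((P⁻¹.val * t.1.1.val.val * P.val) 0 0)) * (X - C (finGammaTwo L v t.1)) :=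
      charpoly_frame_mul_diagonal_mul P _ _
    have h2 : finCharpolyTwo L v t.1 = (X - C ((P⁻¹.val * t.1.1.val.val * P.val) 0 0)) * (X - C ((P⁻¹.val * t.1.1.val.val * P.val) 1 1)) :=
      charpoly_eq_of_mul_frame_eq P (hframe t)
    have h3 : finGammaTwo L v (τ t) = (P⁻¹.val * t.1.1.val.val * P.val) 1 1 := by
      change (((P⁻¹.val * t.1.1.val.val * P.val) 1 1) • (1 : Matrix (Fin 1) (Fin 1) (LocalRing L v))) 0 0 = _
      rw [Matrix.smul_apply, Matrix.one_apply_eq, smul_eq_mul, mul_one]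
    rw [h1, h2, h3]
    ring
  refine ⟨τ ⟨εH, Subgroup.mem_centralizer_singleton_iff.2 rfl⟩, τ, hτc, rfl, ?_, ?_, hchar, ?_⟩
  · -- `ε♭.1 = u·1₂`
    change P.val * diagonal ![(P⁻¹.val * εH.1.val.val * P.val) 0 0, finGammaTwo L v εH] * P⁻¹.val = _
    rw [← hAdef, hPAP, diagonal_apply_eq, hd0]
    have hc : (![finGammaTwo L v εH, finGammaTwo L v εH] : Fin 2 → LocalRing L v) = fun _ => finGammaTwo L v εH := by
      funext i; fin_cases i <;> rfl
    rw [hc, ← smul_one_eq_diagonal, Matrix.mul_smul, Matrix.mul_one, Matrix.smul_mul, hPP']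
  · -- `finGammaTwo ε♭ = d 1 ≠ u`
    change (((P⁻¹.val * εH.1.val.val * P.val) 1 1) • (1 : Matrix (Fin 1) (Fin 1) (LocalRing L v))) 0 0 ≠ finGammaTwo L v εH
    rw [Matrix.smul_apply, Matrix.one_apply_eq, smul_eq_mul, mul_one, ← hAdef, hPAP, diagonal_apply_eq, ← hd0]
    exact hd01.symm
  · -- `G`-regularity is a property of the characteristic polynomial of `ι`
    intro t ht
    have ht' : (((endoEmbLocal L v (t : (cmDatum L 2 (Matrix.of fun i j : Fin 2 => if i.val + j.val + 1 = 2 then (1 : L) else 0)).Local v ×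
        (cmDatum L 1 (Matrix.of fun i j : Fin 1 => if i.val + j.val + 1 = 1 then (1 : L) else 0)).Local v)).val : GL (Fin 3) (LocalRing L v)) :
        Matrix (Fin 3) (Fin 3) (LocalRing L v)).charpoly.Separable := ht
    change (((endoEmbLocal L v (τ t)).val : GL (Fin 3) (LocalRing L v)) : Matrix (Fin 3) (Fin 3) (LocalRing L v)).charpoly.Separable
    rw [hchar t]
    exact ht'


end CM

end Literature.NumberTheory.Rogawski1990

end
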